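import Literature.NumberTheory.LFunctions.ChebotarevCrossingPushDown
import Literature.NumberTheory.LFunctions.PrimeIdealCountRatioProofs
import Literature.NumberTheory.GaloisRepresentations.FrobeniusFixedFieldPrimesProofs
import HarnessLib

/-!
# An unconditional upper bound for the natural density of a Frobenius set (via the prime ideal theorem)

Topic `Literature/NumberTheory/LFunctions`; namespace `Literature.NumberTheory.LFunctions.Chebotarev`
(that of `ChebotarevDensity.lean` / `ChebotarevDensityNumberField.lean`).  Everything in this
file is PROVED (theorems only, nothing is defined, no named fact).

Chebotarev's theorem in *natural*-density form (`π_C(x) ∼ (#C/#G) π(x)`, Serre 1981, §2.1,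
Thm. 1 with eq. (9)) is not in the tree (the tree's `Chebotarev.dirichletDensity_eq`, now a
theorem, is the Dirichlet-density form, which does not bound natural densities from above).  For
the application to supersingular primes (Serre 1981, §8; `EllipticCurves/SupersingularDensity*`)
an **upper bound** suffices, and the following one is unconditional, its only analytic input
being Landau's prime ideal theorem (the tree's theorem `primeIdealTheorem_holds`):

* `card_primesLE_filter_natPrimesOf_primesOfFrobIn_mul_le` — for a finite Galois `L/ℚ` with
  group `G`, an intermediate field `E` with `H = Gal(L/E)`, and `C ⊆ G` with
  `k · #H ≤ #{y ∈ G : y⁻¹ g y ∈ H}` for all `g ∈ C` (i.e. every `g ∈ C` has at least `k` fixed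
  points on `G/H`): `k · #{p ≤ x : p below primesOfFrobIn ℚ L C} ≤ π_E(x)` — each such `p`
  has at least `k` primes of `E` of norm `p` above it
  (`GaloisRepresentations.card_conj_mem_fixingSubgroup_le`, Marcus Ch. 4 Thm. 33);
* `eventually_card_primesLE_filter_natPrimesOf_primesOfFrobIn_le` — hence, by `π_E(x) ∼ π(x)`
  (`NumberField.tendsto_primeIdealCount_div_primeCounting`), for every `η > 0` eventually
  `#{p ≤ x : …} ≤ (1/k + η) π(x)`: **the upper natural density is at most `1/k`**; variants
  `…_le_of_subgroup` (datum `H ≤ Gal(L/ℚ)`, `E = L^H`) and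
  `eventually_card_primesLE_filter_le_of_frobCondition` (a set of primes agreeing with
  `primesOfFrobIn ℚ L C` up to finitely many exceptions);
* `exists_intermediateField_mulEquiv_frobCondition_iff` — the `Γ_ℚ`-to-finite-level dictionary
  of `ChebotarevDensityNumberField.lean` (`exists_intermediateField_frobCondition_iff`), refined to
  remember the group isomorphism `Gal(L/ℚ) ≃* G` (same proof);
* `eventually_card_primesLE_filter_frobPrimes_le` — **the `Γ_ℚ`-form**: for `φ : Γ_ℚ ↠ G` with
  open kernel, `H ≤ G`, `k ≥ 1` and a conjugation-stable `C ⊆ G` all of whose elements have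
  `≥ k` fixed points on `G/H`, the set `frobPrimes φ C` has upper natural density `≤ 1/k`.

This is the classical mechanism by which the prime ideal theorem of the subfields `L^H` yields
natural densities of Frobenius sets (Frobenius 1896 for divisions; Landau 1903 for the
natural-density prime ideal theorem), in the one-sided form that needs a single subgroup.

## References

* J.-P. Serre, *Quelques applications du théorème de densité de Chebotarev*, Publ. Math. IHÉS 54
  (1981), §2.1 (Thm. 1, eq. (9): natural density). [Serre1981]
* D. A. Marcus, *Number Fields*, 2nd ed., Springer 2018, Ch. 4, Thm. 33. [Marcus2018]
* E. Landau, Math. Ann. 56 (1903), 645–670 (Primidealsatz). [LandauMathAnn1903]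
* J. Neukirch, *Algebraic Number Theory*, Springer 1999, Ch. I §9. [NeukirchANT1999]
-/

noncomputable section

open Filter IsDedekindDomain
open scoped NumberField Topology Classical Pointwise

namespace Literature.NumberTheory.LFunctions.Chebotarev

open Field GaloisRepresentations Rat.HeightOneSpectrum NumberField

/-! ### The `Γ_F`-to-finite-level dictionary, with the group isomorphism -/

/-- **A finite quotient of `Γ_F` is cut out by a finite Galois extension, compatibly with Frobenii
and inertia — with the isomorphism `Gal(L/F) ≃* G`.**  Same statement and proof as the tree's
`exists_intermediateField_frobCondition_iff` (`ChebotarevDensityNumberField.lean`; Neukirch I §9),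
except that the transport `C' = Ψ⁻¹(C)` is made explicit through the group isomorphism
`Ψ : Gal(L/F) ≃* G` induced by `φ` (so that subgroup data on `G` can be moved to `Gal(L/F)`), and
the finite exceptional set `T` (the primes ramified in `L = F̄^{ker φ}`) serves every `C ⊆ G` at
once. [cite: NeukirchANT1999, Ch. I §9 Prop. (9.4)–(9.6)] -/
theorem exists_intermediateField_mulEquiv_frobCondition_iff {F : Type*} [Field F] [NumberField F]
    {G : Type*} [Group G] [Finite G] (φ : absoluteGaloisGroup F →* G)
    (hker : IsOpen (φ.ker : Set (absoluteGaloisGroup F))) (hsurj : Function.Surjective φ) :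
    ∃ (L : IntermediateField F (AlgebraicClosure F)) (_ : FiniteDimensional F L)
      (_ : IsGalois F L) (_ : NumberField L) (Ψ : (L ≃ₐ[F] L) ≃* G)
      (T : Set (HeightOneSpectrum (𝓞 F))), T.Finite ∧
      ∀ (C : Set G), ∀ v ∉ T,
        ((∀ 𝔓 ∈ v.primesAbove, ∀ σ ∈ 𝔓.inertia (absoluteGaloisGroup F), φ σ = 1) ∧
          (∀ 𝔓 ∈ v.primesAbove, ∀ σ : absoluteGaloisGroup F,
            IsArithFrobAt (𝓞 F) σ 𝔓 → φ σ ∈ C) ↔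
        v ∈ primesOfFrobIn F L (Ψ ⁻¹' C)) := by
  classical
  -- Step 0: the finite Galois extension `L = F̄^{ker φ}` and the restriction `r : Γ_F → Gal(L/F)`
  -- Step 0: the finite Galois extension `L = F̄^{ker φ}` and the restriction `r : Γ_F → Gal(L/F)`
  set N : Subgroup (absoluteGaloisGroup F) := φ.ker with hNdef
  set L : IntermediateField F (AlgebraicClosure F) := IntermediateField.fixedField N with hLdef
  have hLN : L.fixingSubgroup = N := fixingSubgroup_fixedField_of_isOpen N hker
  haveI : FiniteDimensional F L := finiteDimensional_fixedField_of_isOpen N hker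
  haveI : IsGalois F L := by
    rw [← InfiniteGalois.normal_iff_isGalois, hLN, hNdef]
    exact MonoidHom.normal_ker _
  haveI : NumberField L := NumberField.of_module_finite F L
  set r : absoluteGaloisGroup F →* (L ≃ₐ[F] L) :=
    (AlgEquiv.restrictNormalHom L).comp (absoluteGaloisGroup.toAlgEquiv F).toMonoidHom with hrdef
  have hr : ∀ (γ : absoluteGaloisGroup F) (x : L),
      ((r γ x : L) : AlgebraicClosure F) = γ • (x : AlgebraicClosure F) :=
    fun γ x ↦ AlgEquiv.restrictNormalHom_apply L _ x
  have hrker : ∀ γ : absoluteGaloisGroup F, r γ = 1 ↔ φ γ = 1 := by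
    intro γ
    have key : r γ = 1 ↔ ∀ x : L, γ • (x : AlgebraicClosure F) = x := by
      constructor
      · intro h x
        rw [← hr γ x, h, AlgEquiv.one_apply]
      · intro h
        ext x
        rw [hr γ x, AlgEquiv.one_apply]
        exact h x
    have key2 : γ ∈ N ↔ ∀ x : L, γ • (x : AlgebraicClosure F) = x := by
      rw [← hLN]
      exact mem_fixingSubgroup_iff_forall_smul L γ
    rw [key, ← key2, hNdef, MonoidHom.mem_ker]
  have hrsurj : Function.Surjective r :=
    (AlgEquiv.restrictNormalHom_surjective (AlgebraicClosure F)).comp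
      (absoluteGaloisGroup.toAlgEquiv F).surjective
  -- `ψ : Gal(L/F) → G` with `ψ ∘ r = φ`, a bijection
  have hkerle : r.ker ≤ φ.ker := fun γ hγ ↦ (hrker γ).mp hγ
  obtain ⟨ψ, hψ⟩ : ∃ ψ : (L ≃ₐ[F] L) →* G, ∀ γ, ψ (r γ) = φ γ :=
    ⟨(r.liftOfRightInverse (Function.surjInv hrsurj) (Function.rightInverse_surjInv hrsurj))
      ⟨φ, hkerle⟩, fun γ ↦ r.liftOfRightInverse_comp_apply (Function.surjInv hrsurj)
        (Function.rightInverse_surjInv hrsurj) ⟨φ, hkerle⟩ γ⟩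
  have hψinj : Function.Injective ψ := by
    intro a b hab
    obtain ⟨α, rfl⟩ := hrsurj a
    obtain ⟨β, rfl⟩ := hrsurj b
    rw [hψ, hψ] at hab
    have h1 : φ (α * β⁻¹) = 1 := by rw [map_mul, map_inv, hab, mul_inv_cancel]
    have h2 : r (α * β⁻¹) = 1 := (hrker _).mpr h1
    rwa [map_mul, map_inv, mul_inv_eq_one] at h2
  have hψsurj : Function.Surjective ψ := fun g ↦ by
    obtain ⟨γ, rfl⟩ := hsurj g
    exact ⟨r γ, hψ γ⟩
  -- the group isomorphism `Ψ : Gal(L/F) ≃* G`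
  let Ψ : (L ≃ₐ[F] L) ≃* G := MulEquiv.ofBijective ψ ⟨hψinj, hψsurj⟩
  have hΨ : ∀ x, Ψ x = ψ x := fun x ↦ rfl
  -- Step 1: primes of `\bar ℤ_F`, of `𝓞 L`, and the Frobenius / inertia transfer along `r`
  set ιL := EllipticCurves.ringOfIntegersToIntegralClosure (k := F) (Ω := AlgebraicClosure F) L
    with hιLdef
  have hιalg : ∀ x : 𝓞 F, ιL (algebraMap (𝓞 F) (𝓞 L) x) =
      algebraMap (𝓞 F) (absIntegers (𝓞 F) F) x := fun x ↦ rfl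
  -- (a) pulling back a prime `𝔓 ∣ v` of `\bar ℤ_F` to `𝓞 L` gives a prime of `𝓞 L` over `v`
  have hcomap : ∀ {v : HeightOneSpectrum (𝓞 F)} {𝔓 : Ideal (absIntegers (𝓞 F) F)},
      𝔓 ∈ v.primesAbove → 𝔓.comap ιL ∈ v.asIdeal.primesOver (𝓞 L) := by
    intro v 𝔓 h𝔓
    haveI := h𝔓.1
    refine ⟨Ideal.comap_isPrime ιL 𝔓, ⟨?_⟩⟩
    rw [h𝔓.2.over]
    ext x
    simp only [Ideal.under, Ideal.mem_comap]
    exact Iff.of_eq (congrArg (· ∈ 𝔓) (hιalg x)).symm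
  -- (b) `r` is compatible with the actions on `𝓞 L` and `\bar ℤ_F`
  have hrsmul : ∀ (γ : absoluteGaloisGroup F) (y : 𝓞 L), ιL (r γ • y) = γ • ιL y := by
    intro γ y
    apply Subtype.ext
    rw [integralClosure.coe_smul, EllipticCurves.coe_ringOfIntegersToIntegralClosure,
      EllipticCurves.coe_ringOfIntegersToIntegralClosure]
    exact hr γ y
  -- (c) `r Φ` is a Frobenius at `𝔓 ∩ 𝓞 L` whenever `Φ` is one at `𝔓`
  have hrfrob : ∀ {v : HeightOneSpectrum (𝓞 F)} {𝔓 : Ideal (absIntegers (𝓞 F) F)}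
      (h𝔓 : 𝔓 ∈ v.primesAbove) {Φ : absoluteGaloisGroup F}, IsArithFrobAt (𝓞 F) Φ 𝔓 →
      IsArithFrobAt (𝓞 F) (r Φ) (𝔓.comap ιL) := by
    intro v 𝔓 h𝔓 Φ hΦ y
    rw [MulSemiringAction.toAlgHom_apply]
    have h3 : 𝔓.under (𝓞 F) = (𝔓.comap ιL).under (𝓞 F) := by
      rw [← h𝔓.2.over, ← (hcomap h𝔓).2.over]
    have h2 := hΦ (ιL y)
    rw [MulSemiringAction.toAlgHom_apply, h3] at h2
    have h4 : ιL (r Φ • y - y ^ Nat.card (𝓞 F ⧸ (𝔓.comap ιL).under (𝓞 F))) ∈ 𝔓 := by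
      rw [map_sub ιL, map_pow ιL, hrsmul]
      exact h2
    exact Ideal.mem_comap.mpr h4
  -- (d) `r` maps the inertia group of `𝔓` into that of `𝔓 ∩ 𝓞 L`
  have hrinertia : ∀ {𝔓 : Ideal (absIntegers (𝓞 F) F)} {γ : absoluteGaloisGroup F},
      γ ∈ 𝔓.inertia (absoluteGaloisGroup F) → r γ ∈ (𝔓.comap ιL).inertia (L ≃ₐ[F] L) := by
    intro 𝔓 γ hγ y
    have h4 : ιL (r γ • y - y) ∈ 𝔓 := by
      rw [map_sub ιL, hrsmul]
      exact hγ (ιL y)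
    exact Ideal.mem_comap.mpr h4
  -- (e) above every prime `Q` of `𝓞 L` there is a prime `𝔓` of `\bar ℤ_F`
  have hexists : ∀ (Q : Ideal (𝓞 L)) [Q.IsPrime],
      ∃ 𝔓 : Ideal (absIntegers (𝓞 F) F), 𝔓.IsPrime ∧ 𝔓.comap ιL = Q := by
    intro Q _
    letI : Algebra (𝓞 L) (absIntegers (𝓞 F) F) := ιL.toAlgebra
    haveI : IsScalarTower (𝓞 F) (𝓞 L) (absIntegers (𝓞 F) F) :=
      IsScalarTower.of_algebraMap_eq fun x ↦ (hιalg x).symm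
    haveI : Algebra.IsIntegral (𝓞 L) (absIntegers (𝓞 F) F) :=
      ⟨fun x ↦ (Algebra.IsIntegral.isIntegral (R := 𝓞 F) x).tower_top⟩
    obtain ⟨𝔓, -, h𝔓prime, h𝔓Q⟩ := Ideal.exists_ideal_over_prime_of_isIntegral Q
      (⊥ : Ideal (absIntegers (𝓞 F) F))
      (fun x hx ↦ by
        rw [Ideal.mem_comap, Ideal.mem_bot] at hx
        have hx0 : x = 0 :=
          EllipticCurves.ringOfIntegersToIntegralClosure_injective L (hx.trans (map_zero _).symm)
        rw [hx0]
        exact Q.zero_mem)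
    exact ⟨𝔓, h𝔓prime, h𝔓Q⟩
  -- Step 2: the equivalence at the primes unramified in `L`, for every `C ⊆ G`
  refine ⟨L, inferInstance, inferInstance, inferInstance, Ψ,
    {v | ¬ Algebra.IsUnramifiedIn (𝓞 L) v.asIdeal}, finite_setOf_not_isUnramifiedIn F L,
    fun C v hv ↦ ?_⟩
  have hunr : Algebra.IsUnramifiedIn (𝓞 L) v.asIdeal := not_not.mp hv
  rw [mem_primesOfFrobIn_iff]
  constructor
  · rintro ⟨-, hfrob⟩
    refine ⟨hunr, fun Q hQ τ hτ ↦ ?_⟩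
    haveI := hQ.1
    obtain ⟨𝔓, h𝔓prime, h𝔓Q⟩ := hexists Q
    haveI := h𝔓prime
    have h𝔓v : 𝔓 ∈ v.primesAbove := by
      refine ⟨h𝔓prime, ⟨?_⟩⟩
      rw [hQ.2.over, ← h𝔓Q]
      ext x
      simp only [Ideal.under, Ideal.mem_comap]
      exact Iff.of_eq (congrArg (· ∈ 𝔓) (hιalg x))
    obtain ⟨Φ, hΦ⟩ := HeightOneSpectrum.exists_isArithFrobAt_of_mem_primesAbove_holds h𝔓v
    have hrΦ : IsArithFrobAt (𝓞 F) (r Φ) Q := h𝔓Q ▸ hrfrob h𝔓v hΦ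
    have hτeq : τ = r Φ := eq_of_isArithFrobAt_of_isUnramifiedIn hunr hQ hτ hrΦ
    change Ψ τ ∈ C
    rw [hΨ, hτeq, hψ]
    exact hfrob 𝔓 h𝔓v Φ hΦ
  · rintro ⟨-, hall⟩
    refine ⟨fun 𝔓 h𝔓 γ hγ ↦ ?_, fun 𝔓 h𝔓 Φ hΦ ↦ ?_⟩
    · have hbot := inertia_eq_bot_of_isUnramifiedIn hunr (hcomap h𝔓)
      have hmem := hrinertia (𝔓 := 𝔓) hγ
      rw [hbot, Subgroup.mem_bot] at hmem
      exact (hrker γ).mp hmem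
    · have hmem := hall _ (hcomap h𝔓) (r Φ) (hrfrob h𝔓 hΦ)
      change Ψ (r Φ) ∈ C at hmem
      rwa [hΨ, hψ] at hmem




/-! ### The finite-level count and the upper density bound over `ℚ` -/

section FiniteLevel

variable {L : Type} [Field L] [instNF : NumberField L] {instAlg : Algebra ℚ L}
  [instGal : IsGalois ℚ L]

/-- **Pointwise count.**  Let `L/ℚ` be finite Galois with group `G`, `E` an intermediate field with
`H = Gal(L/E)`, `k ∈ ℕ`, and `C ⊆ G` such that every `g ∈ C` satisfies
`k · #H ≤ #{y ∈ G : y⁻¹ g y ∈ H}` (at least `k` fixed points on `G/H`).  Then every rational prime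
`p` below `primesOfFrobIn ℚ L C` has at least `k` primes of `E` of norm `p` above it:
`k ≤ #{𝔓 ⊆ 𝓞_E : N𝔓 = p}` (`GaloisRepresentations.card_conj_mem_fixingSubgroup_le` at a Frobenius
`φ ∈ C` of a prime `Q ∣ p`). [cite: Marcus2018, Ch. 4, Thm. 33] -/
theorem le_normPrimeIdealCount_of_mem_natPrimesOf_primesOfFrobIn (E : IntermediateField ℚ L)
    [NumberField E] {k : ℕ} {C : Set (L ≃ₐ[ℚ] L)}
    (hCk : ∀ g ∈ C, k * Nat.card E.fixingSubgroup ≤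
      Nat.card {y : L ≃ₐ[ℚ] L // y⁻¹ * g * y ∈ E.fixingSubgroup})
    {p : ℕ} (hp : p ∈ natPrimesOf (primesOfFrobIn ℚ L C)) :
    k ≤ NumberField.normPrimeIdealCount E p := by
  obtain ⟨v, ⟨hunr, hall⟩, rfl⟩ := hp
  obtain ⟨Q, hQ, φ, hφ⟩ := exists_isArithFrobAt_of_heightOneSpectrum (L := L) v
  have hφC : φ ∈ C := hall Q hQ φ hφ
  have h1 := hCk φ hφC
  have h2 := card_conj_mem_fixingSubgroup_le E hunr hQ hφ
  rw [absNorm_eq_primesEquiv] at h2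
  have hH : 0 < Nat.card E.fixingSubgroup := Nat.card_pos
  exact Nat.le_of_mul_le_mul_right (h1.trans (by rw [mul_comm]; exact h2)) hH

/-- **`k · #{p ≤ x : p below primesOfFrobIn ℚ L C} ≤ π_E(x)`** under the fixed-point hypothesis
of `le_normPrimeIdealCount_of_mem_natPrimesOf_primesOfFrobIn`: sum the pointwise count over the
primes `p ≤ x` and compare with `π_E(x) = Σ_{n ≤ x} #{𝔓 : N𝔓 = n}`
(`NumberField.primeIdealCount_eq_sum_normPrimeIdealCount`). [cite: Marcus2018, Ch. 4, Thm. 33] -/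
theorem card_primesLE_filter_natPrimesOf_primesOfFrobIn_mul_le (E : IntermediateField ℚ L)
    [NumberField E] {k : ℕ} {C : Set (L ≃ₐ[ℚ] L)}
    (hCk : ∀ g ∈ C, k * Nat.card E.fixingSubgroup ≤
      Nat.card {y : L ≃ₐ[ℚ] L // y⁻¹ * g * y ∈ E.fixingSubgroup})
    (x : ℕ) :
    k * ((Nat.primesLE x).filter (· ∈ natPrimesOf (primesOfFrobIn ℚ L C))).card ≤
      NumberField.primeIdealCount E x := by
  set A := (Nat.primesLE x).filter (· ∈ natPrimesOf (primesOfFrobIn ℚ L C)) with hA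
  have h1 : k * A.card ≤ ∑ p ∈ A, NumberField.normPrimeIdealCount E p := by
    rw [mul_comm, Finset.card_eq_sum_ones, Finset.sum_mul, one_mul]
    refine Finset.sum_le_sum fun p hp ↦ ?_
    rw [hA, Finset.mem_filter] at hp
    exact le_normPrimeIdealCount_of_mem_natPrimesOf_primesOfFrobIn E hCk hp.2
  have h2 : ∑ p ∈ A, NumberField.normPrimeIdealCount E p ≤
      ∑ n ∈ Finset.Icc 0 x, NumberField.normPrimeIdealCount E n := by
    refine Finset.sum_le_sum_of_subset_of_nonneg (fun p hp ↦ ?_) fun _ _ _ ↦ Nat.zero_le _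
    rw [hA, Finset.mem_filter, Nat.mem_primesLE] at hp
    exact Finset.mem_Icc.mpr ⟨Nat.zero_le _, hp.1.1⟩
  have h3 : NumberField.primeIdealCount E x = ∑ n ∈ Finset.Icc 0 x, NumberField.normPrimeIdealCount E n := by
    rw [NumberField.primeIdealCount_eq_sum_normPrimeIdealCount E (Nat.cast_nonneg x), Nat.floor_natCast]
  rw [h3]
  exact h1.trans h2

/-- **Upper natural density `≤ 1/k`.**  Under the fixed-point hypothesis (every `g ∈ C` has at
least `k ≥ 1` fixed points on `G/H`, `H = Gal(L/E)`), for every `η > 0`, eventually in `x`: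
`#{p ≤ x : p below primesOfFrobIn ℚ L C} ≤ (1/k + η) · π(x)` — from
`card_primesLE_filter_natPrimesOf_primesOfFrobIn_mul_le` and the prime ideal theorem for `E` in
the form `π_E(x)/π(x) → 1` (`NumberField.tendsto_primeIdealCount_div_primeCounting`).  This is the
natural-density ("`π_C(x) ≤ (λ + o(1)) x/log x`") half of Serre's Thm. 1 (1981, §2.1, eq. (9)) for
such `C`, with `λ = 1/k`. [cite: Serre1981, §2.1 Thm. 1 eq. (9)] -/
theorem eventually_card_primesLE_filter_natPrimesOf_primesOfFrobIn_le (E : IntermediateField ℚ L)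
    [NumberField E] {k : ℕ} (hk : 0 < k) {C : Set (L ≃ₐ[ℚ] L)}
    (hCk : ∀ g ∈ C, k * Nat.card E.fixingSubgroup ≤
      Nat.card {y : L ≃ₐ[ℚ] L // y⁻¹ * g * y ∈ E.fixingSubgroup})
    {η : ℝ} (hη : 0 < η) :
    ∀ᶠ x : ℕ in atTop,
      ((((Nat.primesLE x).filter (· ∈ natPrimesOf (primesOfFrobIn ℚ L C))).card : ℝ)) ≤
        (1 / k + η) * Nat.primeCounting x := by
  have hk' : (0 : ℝ) < k := by exact_mod_cast hk
  have hlim := NumberField.tendsto_primeIdealCount_div_primeCounting E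
  have h1 : ∀ᶠ x : ℕ in atTop,
      (NumberField.primeIdealCount E x : ℝ) / Nat.primeCounting x < 1 + k * η :=
    hlim.eventually (gt_mem_nhds (by nlinarith))
  have h2 : ∀ᶠ x : ℕ in atTop, 0 < Nat.primeCounting x :=
    Nat.tendsto_primeCounting.eventually (eventually_gt_atTop 0)
  filter_upwards [h1, h2] with x hx hπ
  have hπ' : (0 : ℝ) < Nat.primeCounting x := by exact_mod_cast hπ
  rw [div_lt_iff₀ hπ'] at hx
  have hcount := card_primesLE_filter_natPrimesOf_primesOfFrobIn_mul_le E hCk x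
  have hcount' : (k : ℝ) * ((Nat.primesLE x).filter
      (· ∈ natPrimesOf (primesOfFrobIn ℚ L C))).card ≤ NumberField.primeIdealCount E x := by
    exact_mod_cast hcount
  have hmain : (k : ℝ) * ((((Nat.primesLE x).filter
      (· ∈ natPrimesOf (primesOfFrobIn ℚ L C))).card : ℝ)) ≤ (1 + k * η) * Nat.primeCounting x :=
    hcount'.trans hx.le
  calc ((((Nat.primesLE x).filter (· ∈ natPrimesOf (primesOfFrobIn ℚ L C))).card : ℝ))
      = ((k : ℝ) * ((((Nat.primesLE x).filter
          (· ∈ natPrimesOf (primesOfFrobIn ℚ L C))).card : ℝ))) / k := by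
        field_simp
    _ ≤ ((1 + k * η) * Nat.primeCounting x) / k := div_le_div_of_nonneg_right hmain hk'.le
    _ = (1 / k + η) * Nat.primeCounting x := by
        field_simp

/-- **Upper natural density `≤ 1/k`, subgroup form.**  The same bound with the datum a subgroup
`H ≤ Gal(L/ℚ)` instead of its fixed field (`E = L^H`, `Gal(L/E) = H` by the Galois
correspondence, Mathlib `IntermediateField.fixingSubgroup_fixedField`): if every `g ∈ C` satisfies
`k · #H ≤ #{y : y⁻¹ g y ∈ H}` then for every `η > 0`, eventually
`#{p ≤ x : p below primesOfFrobIn ℚ L C} ≤ (1/k + η) π(x)`. [cite: Serre1981, §2.1 Thm. 1 eq. (9)] -/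
theorem eventually_card_primesLE_filter_natPrimesOf_primesOfFrobIn_le_of_subgroup
    [FiniteDimensional ℚ L] (H : Subgroup (L ≃ₐ[ℚ] L)) {k : ℕ} (hk : 0 < k)
    {C : Set (L ≃ₐ[ℚ] L)}
    (hCk : ∀ g ∈ C, k * Nat.card H ≤ Nat.card {y : L ≃ₐ[ℚ] L // y⁻¹ * g * y ∈ H})
    {η : ℝ} (hη : 0 < η) :
    ∀ᶠ x : ℕ in atTop,
      ((((Nat.primesLE x).filter (· ∈ natPrimesOf (primesOfFrobIn ℚ L C))).card : ℝ)) ≤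
        (1 / k + η) * Nat.primeCounting x := by
  set E : IntermediateField ℚ L := IntermediateField.fixedField H with hE
  have hEH : E.fixingSubgroup = H := IntermediateField.fixingSubgroup_fixedField H
  haveI : NumberField E := NumberField.of_module_finite ℚ E
  have hCk' : ∀ g ∈ C, k * Nat.card E.fixingSubgroup ≤
      Nat.card {y : L ≃ₐ[ℚ] L // y⁻¹ * g * y ∈ E.fixingSubgroup} := by
    simp_rw [hEH]
    exact hCk
  exact eventually_card_primesLE_filter_natPrimesOf_primesOfFrobIn_le E hk hCk' hη

/-- **Upper natural density `≤ 1/k` for a set of primes agreeing with a Frobenius set up to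
finitely many exceptions.**  If `S ⊆ ℕ` and `primesOfFrobIn ℚ L C` have the same primes outside a
finite set `T` of primes of `ℚ`, then under the fixed-point hypothesis for `C` and `H ≤ Gal(L/ℚ)`,
for every `η > 0`, eventually `#{p ≤ x : p ∈ S} ≤ (1/k + η) π(x)` (the finitely many exceptions
are `o(π(x))`, Mathlib `Nat.tendsto_primeCounting`). [cite: Serre1981, §2.1 Thm. 1 eq. (9)] -/
theorem eventually_card_primesLE_filter_le_of_frobCondition [FiniteDimensional ℚ L]
    (H : Subgroup (L ≃ₐ[ℚ] L)) {k : ℕ} (hk : 0 < k) {C : Set (L ≃ₐ[ℚ] L)}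
    (hCk : ∀ g ∈ C, k * Nat.card H ≤ Nat.card {y : L ≃ₐ[ℚ] L // y⁻¹ * g * y ∈ H})
    {S : Set ℕ} {T : Set (HeightOneSpectrum (𝓞 ℚ))} (hT : T.Finite)
    (hagree : ∀ v ∉ T, ((primesEquiv v : Nat.Primes) : ℕ) ∈ S ↔ v ∈ primesOfFrobIn ℚ L C)
    {η : ℝ} (hη : 0 < η) :
    ∀ᶠ x : ℕ in atTop,
      ((((Nat.primesLE x).filter (· ∈ S)).card : ℝ)) ≤ (1 / k + η) * Nat.primeCounting x := by
  have h1 := eventually_card_primesLE_filter_natPrimesOf_primesOfFrobIn_le_of_subgroup H hk hCk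
    (half_pos hη)
  have hTfin : (natPrimesOf T).Finite := natPrimesOf_finite hT
  have h2 : ∀ᶠ x : ℕ in atTop, ((hTfin.toFinset.card : ℝ)) ≤ (η / 2) * Nat.primeCounting x := by
    have hlim : Tendsto (fun x : ℕ ↦ (η / 2) * (Nat.primeCounting x : ℝ)) atTop atTop :=
      (tendsto_natCast_atTop_atTop.comp Nat.tendsto_primeCounting).const_mul_atTop (half_pos hη)
    exact hlim.eventually (eventually_ge_atTop _)
  filter_upwards [h1, h2] with x hx hx2
  -- `filter S ⊆ filter (natPrimesOf (primesOfFrobIn ℚ L C)) ∪ natPrimesOf T`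
  have hsub : (Nat.primesLE x).filter (· ∈ S) ⊆
      (Nat.primesLE x).filter (· ∈ natPrimesOf (primesOfFrobIn ℚ L C)) ∪ hTfin.toFinset := by
    intro p hp
    rw [Finset.mem_filter, Nat.mem_primesLE] at hp
    obtain ⟨⟨hpx, hpp⟩, hpS⟩ := hp
    rw [Finset.mem_union, Finset.mem_filter, Nat.mem_primesLE, Set.Finite.mem_toFinset]
    by_cases hvT : primesEquiv.symm ⟨p, hpp⟩ ∈ T
    · right
      exact ⟨_, hvT, by rw [Equiv.apply_symm_apply]⟩
    · left
      refine ⟨⟨hpx, hpp⟩, ?_⟩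
      set v : HeightOneSpectrum (𝓞 ℚ) := primesEquiv.symm ⟨p, hpp⟩ with hv
      have hpv : ((primesEquiv v : Nat.Primes) : ℕ) = p := by rw [hv, Equiv.apply_symm_apply]
      rw [← hpv, primesEquiv_mem_natPrimesOf_iff, ← hagree v hvT, hpv]
      exact hpS
  have hcard := (Finset.card_le_card hsub).trans (Finset.card_union_le _ _)
  have hcardR : ((((Nat.primesLE x).filter (· ∈ S)).card : ℝ)) ≤
      ((Nat.primesLE x).filter (· ∈ natPrimesOf (primesOfFrobIn ℚ L C))).card +
        hTfin.toFinset.card := by exact_mod_cast hcard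
  calc ((((Nat.primesLE x).filter (· ∈ S)).card : ℝ))
      ≤ ((Nat.primesLE x).filter (· ∈ natPrimesOf (primesOfFrobIn ℚ L C))).card +
          hTfin.toFinset.card := hcardR
    _ ≤ (1 / k + η / 2) * Nat.primeCounting x + (η / 2) * Nat.primeCounting x := add_le_add hx hx2
    _ = (1 / k + η) * Nat.primeCounting x := by ring

end FiniteLevel

/-! ### The `Γ_ℚ`-form -/

/-- Transport of the fixed-point count along a group isomorphism. [folklore] -/
theorem natCard_conj_mem_comap_eq {G₁ G₂ : Type*} [Group G₁] [Group G₂] (Ψ : G₁ ≃* G₂)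
    (H : Subgroup G₂) (g : G₁) :
    Nat.card {y : G₁ // y⁻¹ * g * y ∈ H.comap Ψ.toMonoidHom} =
      Nat.card {y : G₂ // y⁻¹ * Ψ g * y ∈ H} := by
  refine Nat.card_congr (Ψ.toEquiv.subtypeEquiv fun y ↦ ?_)
  rw [Subgroup.mem_comap, MulEquiv.coe_toMonoidHom, map_mul, map_mul, map_inv]
  rfl

/-- Transport of the order of a subgroup along a group isomorphism. [folklore] -/
theorem natCard_comap_eq {G₁ G₂ : Type*} [Group G₁] [Group G₂] (Ψ : G₁ ≃* G₂)
    (H : Subgroup G₂) : Nat.card (H.comap Ψ.toMonoidHom) = Nat.card H := by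
  refine Nat.card_congr (Ψ.toEquiv.subtypeEquiv fun y ↦ ?_)
  rw [Subgroup.mem_comap, MulEquiv.coe_toMonoidHom]
  rfl

/-- **Upper natural density of a Frobenius set, `Γ_ℚ`-form.**  Let `φ : Γ_ℚ ↠ G` be a surjection
onto a finite group with open kernel, `H ≤ G`, `k ≥ 1`, and `C ⊆ G` such that every `g ∈ C` has
at least `k` fixed points on `G/H` (`k · #H ≤ #{y : y⁻¹ g y ∈ H}`).  Then for every `η > 0`,
eventually `#{p ≤ x : p ∈ frobPrimes φ C} ≤ (1/k + η) π(x)`: the set `frobPrimes φ C` (the primes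
unramified in `ℚ̄^{ker φ}` with Frobenius class in `C`, as in `Chebotarev.dirichletDensity_eq`) has
upper natural density at most `1/k`.  Proof: pass to `L = ℚ̄^{ker φ}` with
`exists_intermediateField_mulEquiv_frobCondition_iff`, take `E = L^{Ψ⁻¹ H}`, apply
`eventually_card_primesLE_filter_natPrimesOf_primesOfFrobIn_le`, and absorb the finitely many
ramified primes.  Unconditional (prime ideal theorem only). [cite: Serre1981, §2.1 Thm. 1 eq. (9)] -/
theorem eventually_card_primesLE_filter_frobPrimes_le {G : Type*} [Group G] [Finite G]
    (φ : absoluteGaloisGroup ℚ →* G)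
    (hker : IsOpen (φ.ker : Set (absoluteGaloisGroup ℚ))) (hsurj : Function.Surjective φ)
    (H : Subgroup G) {k : ℕ} (hk : 0 < k) (C : Set G)
    (hCk : ∀ g ∈ C, k * Nat.card H ≤ Nat.card {y : G // y⁻¹ * g * y ∈ H}) {η : ℝ} (hη : 0 < η) :
    ∀ᶠ x : ℕ in atTop,
      ((((Nat.primesLE x).filter (· ∈ frobPrimes φ C)).card : ℝ)) ≤
        (1 / k + η) * Nat.primeCounting x := by
  obtain ⟨L, hfd, hgal, hnf, Ψ, T, hT, hagree⟩ :=
    exists_intermediateField_mulEquiv_frobCondition_iff φ hker hsurj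
  haveI := hfd
  haveI := hgal
  haveI := hnf
  -- the fixed-point hypothesis transported to the subgroup `Ψ⁻¹ H` of `Gal(L/ℚ)`
  have hCk' : ∀ g ∈ Ψ ⁻¹' C, k * Nat.card (H.comap Ψ.toMonoidHom) ≤
      Nat.card {y // y⁻¹ * g * y ∈ H.comap Ψ.toMonoidHom} := by
    intro g hg
    rw [natCard_comap_eq, natCard_conj_mem_comap_eq]
    exact hCk (Ψ g) hg
  -- conclude at finite level, the primes ramified in `L` being the finitely many exceptions
  exact eventually_card_primesLE_filter_le_of_frobCondition (H.comap Ψ.toMonoidHom) hk hCk' hT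
    (fun v hv ↦ primesEquiv_mem_frobPrimes_iff.trans (hagree C v hv)) hη

end Literature.NumberTheory.LFunctions.Chebotarev
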